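import Summits.HubbardSuperconductivity.HubbardSuperconductivity.Theorems.AnisotropyChordTransferFibre3FinXB2Eval
import Summits.HubbardSuperconductivity.HubbardSuperconductivity.Theorems.AnisotropyChordTransferFibre3RowDEprim
import Summits.HubbardSuperconductivity.HubbardSuperconductivity.Theorems.AnisotropyChordTransferFibre3N1RowReductions

/-!
# Route `AnisotropyChord` / H0 rotor rung: FIN mid-`L` evaluator XB2 — symmetries of `T`, the involution identity, exact accumulation

Soundness layer 1a of `…Fibre3FinXB2Eval`: the real-level lattice symmetries of `T(k) = Σ_p g(p) g(p − k)` (`Tsum_mirror`,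
`Tsum_swap`, `Tsum_reflect`, `Tsum_natFold`, `Tsum_natSwap`) and of its row sums under the involution `p₁ ↦ k₁ − p₁`
(`rowT_invol`); natural-coordinate casts (`natCast_fold/partner/shift`); the weighted-sum identity for an involution
(`sum_invol_weight`, from `Finset.sum_involution`); the cell table of g4 IS the pair of point tables (`gAt_cell_split`), rows and
checked nonnegativity of the point table (`gPt_row`, `gPtNonneg_spec`); the exact accumulation `dotP` bounds `D²·Σ xy` from below
(nonnegative lower ends) and from above (`dotP_lower`, `dotP_upper`).  Consumed by `…FinXB2Sound` (★ `mem_tTab2`).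
Prover seat `hubbard-h0-rotor-p3` g6; helper for piece A = stmt-HubbardSuperconductivity-23918 of rung 19089 (`--supports`, helper
class).  WHAT THIS IS NOT: nothing here proves superconductivity in the Hubbard model (rotor TARGET as worded stays FALSE, g15 verdict);
soundness lemmas for the FIN certificates of ONE conditional reduction.  Tree imports only; no sorry, no new axioms.
-/

set_option linter.dupNamespace false
set_option autoImplicit false

namespace Summit.HubbardSuperconductivity.HubbardSuperconductivity.Theorems.AnisotropyChord.Transfer.Fibre3

namespace FinXB

open scoped BigOperators
open Finset Hole2 FinCell

variable (L : ℕ) [NeZero L]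

/-! ## Real-level symmetries of `T` -/

/-- `T(k) = Σ_p g(p) g(p − k)`. -/
noncomputable def Tsum (lam : ℝ) (k : Tor L) : ℝ := ∑ p : Tor L, gres L lam p * gres L lam (p - k)

/-- the row sum `c(p₁) = Σ_{p₂} g(p₁,p₂) g((p₁,p₂) − k)`. -/
noncomputable def rowT (lam : ℝ) (k : Tor L) (p1 : ZMod L) : ℝ :=
  ∑ p2 : ZMod L, gres L lam (p1, p2) * gres L lam (((p1, p2) : Tor L) - k)

/-- `T` as the sum of its row sums. [folklore] -/
theorem Tsum_eq_rowT (lam : ℝ) (k : Tor L) : Tsum L lam k = ∑ p1 : ZMod L, rowT L lam k p1 := by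
  unfold Tsum rowT
  rw [Fintype.sum_prod_type]

/-- mirror symmetry `T(−k₁, k₂) = T(k)`. [folklore] -/
theorem Tsum_mirror (lam : ℝ) (k : Tor L) : Tsum L lam (-k.1, k.2) = Tsum L lam k := by
  unfold Tsum
  let σ : Tor L ≃ Tor L := (Equiv.neg (ZMod L)).prodCongr (Equiv.refl (ZMod L))
  rw [← Fintype.sum_equiv σ (fun p => gres L lam (σ p) * gres L lam (σ p - (-k.1, k.2))) _ (fun _ => rfl)]
  refine Fintype.sum_congr _ _ fun p => ?_
  have e1 : σ p = (-p.1, p.2) := rfl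
  have e2 : ((-p.1, p.2) : Tor L) - (-k.1, k.2) = (-(p - k).1, (p - k).2) := by
    ext <;> simp; ring
  rw [e1, e2, RowD.gres_mirror, RowD.gres_mirror]

/-- swap symmetry `T(k₂, k₁) = T(k)`. [folklore] -/
theorem Tsum_swap (lam : ℝ) (k : Tor L) : Tsum L lam (k.2, k.1) = Tsum L lam k := by
  unfold Tsum
  rw [← Fintype.sum_equiv (Equiv.prodComm (ZMod L) (ZMod L))
    (fun p => gres L lam (p.2, p.1) * gres L lam (((p.2, p.1) : Tor L) - (k.2, k.1))) _ (fun _ => rfl)]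
  refine Fintype.sum_congr _ _ fun p => ?_
  have e2 : ((p.2, p.1) : Tor L) - (k.2, k.1) = ((p - k).2, (p - k).1) := by ext <;> simp
  rw [e2, gres_swap, gres_swap]

/-- reflection in the second coordinate. [folklore] -/
theorem Tsum_reflect (lam : ℝ) (k : Tor L) : Tsum L lam (k.1, -k.2) = Tsum L lam k := by
  have h1 := Tsum_swap L lam (k.1, -k.2)
  have h2 := Tsum_mirror L lam (k.2, k.1)
  have h3 := Tsum_swap L lam k
  simp only at h1 h2 h3
  rw [← h1, h2, h3]

/-- the row sums are invariant under the involution `p₁ ↦ k₁ − p₁`. [folklore] -/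
theorem rowT_invol (lam : ℝ) (k : Tor L) (p1 : ZMod L) : rowT L lam k (k.1 - p1) = rowT L lam k p1 := by
  unfold rowT
  rw [← Fintype.sum_equiv (Equiv.subLeft k.2)
    (fun p2 => gres L lam (k.1 - p1, k.2 - p2) * gres L lam (((k.1 - p1, k.2 - p2) : Tor L) - k)) _
    (fun p2 => by simp [Equiv.subLeft])]
  refine Fintype.sum_congr _ _ fun p2 => ?_
  have e1 : ((k.1 - p1, k.2 - p2) : Tor L) = -(((p1, p2) : Tor L) - k) := by ext <;> simp
  have e2 : -(((p1, p2) : Tor L) - k) - k = -((p1, p2) : Tor L) := by abel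
  rw [e1, e2, B1.gres_neg, B1.gres_neg, mul_comm]

/-! ## Natural coordinates -/

omit [NeZero L] in
/-- the folded index represents `±k` in `ZMod L`. [folklore] -/
theorem natCast_fold {k : ℕ} (hk : k < L) :
    ((fold L k : ℕ) : ZMod L) = (k : ZMod L) ∨ ((fold L k : ℕ) : ZMod L) = -(k : ZMod L) := by
  unfold fold
  split_ifs with h
  · exact Or.inl rfl
  · right
    rw [Nat.cast_sub hk.le, ZMod.natCast_self, zero_sub]

/-- `T` at folded natural coordinates. [folklore] -/
theorem Tsum_natFold (lam : ℝ) {k1 k2 : ℕ} (hk1 : k1 < L) (hk2 : k2 < L) :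
    Tsum L lam ((((fold L k1 : ℕ) : ZMod L)), (((fold L k2 : ℕ) : ZMod L)))
      = Tsum L lam ((((k1 : ℕ) : ZMod L)), (((k2 : ℕ) : ZMod L))) := by
  rcases natCast_fold L hk1 with h1 | h1 <;> rcases natCast_fold L hk2 with h2 | h2 <;> rw [h1, h2]
  · have := Tsum_reflect L lam ((((k1 : ℕ) : ZMod L)), (((k2 : ℕ) : ZMod L)))
    exact this
  · exact Tsum_mirror L lam ((((k1 : ℕ) : ZMod L)), (((k2 : ℕ) : ZMod L)))
  · have h := Tsum_mirror L lam ((((k1 : ℕ) : ZMod L)), -(((k2 : ℕ) : ZMod L)))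
    have h' := Tsum_reflect L lam ((((k1 : ℕ) : ZMod L)), (((k2 : ℕ) : ZMod L)))
    simp only at h h'
    rw [h, h']

/-- `T` at swapped natural coordinates. [folklore] -/
theorem Tsum_natSwap (lam : ℝ) (k1 k2 : ℕ) :
    Tsum L lam ((((k2 : ℕ) : ZMod L)), (((k1 : ℕ) : ZMod L))) = Tsum L lam ((((k1 : ℕ) : ZMod L)), (((k2 : ℕ) : ZMod L))) :=
  Tsum_swap L lam ((((k1 : ℕ) : ZMod L)), (((k2 : ℕ) : ZMod L)))

omit [NeZero L] in
/-- the partner index `(k₁ + L − p₁) mod L` represents `k₁ − p₁`. [folklore] -/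
theorem natCast_partner {k1 p1 : ℕ} (hp1 : p1 < L) :
    ((((k1 + L - p1) % L : ℕ)) : ZMod L) = (k1 : ZMod L) - (p1 : ZMod L) := by
  rw [ZMod.natCast_mod, Nat.cast_sub (by omega), Nat.cast_add, ZMod.natCast_self, add_zero]

omit [NeZero L] in
/-- the shifted row index `(p₁ + L − k₁) mod L` represents `p₁ − k₁`. [folklore] -/
theorem natCast_shift {k1 p1 : ℕ} (hk1 : k1 < L) :
    ((((p1 + L - k1) % L : ℕ)) : ZMod L) = (p1 : ZMod L) - (k1 : ZMod L) := by
  rw [ZMod.natCast_mod, Nat.cast_sub (by omega), Nat.cast_add, ZMod.natCast_self, add_zero]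

/-! ## The weighted sum of an involution -/

omit [NeZero L] in
/-- for an involution `s` of `range n` and an `s`-invariant `c`: `Σ c = Σ (2·c on p < s p) + (c on p = s p)`. [folklore] -/
theorem sum_invol_weight (c : ℕ → ℝ) (s : ℕ → ℕ) (n : ℕ) (hs : ∀ p, p < n → s p < n)
    (hss : ∀ p, p < n → s (s p) = p) (hc : ∀ p, p < n → c (s p) = c p) :
    ∑ p ∈ range n, c p = ∑ p ∈ range n, (if p < s p then 2 * c p else if p = s p then c p else 0) := by
  rw [← sub_eq_zero, ← Finset.sum_sub_distrib]
  refine Finset.sum_involution (fun p _ => s p) ?_ ?_ ?_ ?_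
  · intro p hp
    rw [mem_range] at hp
    have h1 := hss p hp
    have h2 := hc p hp
    rw [h1, h2]
    by_cases hlt : p < s p
    · have : ¬ (s p < p) := by omega
      have hne : ¬ (s p = p) := by omega
      rw [if_pos hlt, if_neg this, if_neg hne]; ring
    · by_cases heq : p = s p
      · rw [if_neg hlt, if_pos heq, ← heq, if_neg (lt_irrefl _), if_pos rfl]; ring
      · have : s p < p := by omega
        rw [if_neg hlt, if_neg heq, if_pos this]; ring
  · intro p hp hne
    rw [mem_range] at hp
    intro h
    apply hne
    have : ¬ (p < s p) := by rw [h]; exact lt_irrefl _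
    rw [if_neg this, if_pos h.symm]; ring
  · intro p hp
    rw [mem_range] at hp ⊢
    exact hs p hp
  · intro p hp
    rw [mem_range] at hp
    exact hss p hp

/-! ## The cell table of g4 is the pair of point tables -/

omit [NeZero L] in
/-- the lower end of the cell entry depends only on `la`, the upper end only on `lb`. [folklore] -/
theorem gAt_cell_split (ct : List Iv) (la lb : ℤ) {i j : ℕ} (hi : i < L) (hj : j < L) :
    gAt (gresCellTab L ct la lb) i j
      = ((gAt (gresCellTab L ct la la) i j).1, (gAt (gresCellTab L ct lb lb) i j).2) := by
  unfold gAt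
  by_cases h : i = 0 ∧ j = 0
  · simp only [h, and_self, if_true]
  · simp only [h, if_false]
    rw [getF_gresCellTab ct la lb hi hj, getF_gresCellTab ct la la hi hj, getF_gresCellTab ct lb lb hi hj]
    rfl

omit [NeZero L] in
/-- rows of the point table. [folklore] -/
theorem gPt_row (lam : ℤ) {i : ℕ} (hi : i < L) :
    (gPt L lam).getD i [] = (List.range L).map (gAt (gresCellTab L (cosTab L) lam lam) i) := by
  unfold gPt
  exact mkTab_row _ hi

omit [NeZero L] in
/-- the checked nonnegativity of the lower point ends. [folklore] -/
theorem gPtNonneg_spec {lam : ℤ} (h : gPtNonneg L lam = true) {i j : ℕ} (hi : i < L) (hj : j < L) :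
    0 ≤ (gAt (gresCellTab L (cosTab L) lam lam) i j).1 := by
  unfold gPtNonneg at h
  rw [List.all_eq_true] at h
  have hrow : (gPt L lam).getD i [] ∈ gPt L lam := by
    have hlen : i < (gPt L lam).length := by unfold gPt mkTab; simpa using hi
    rw [List.getD_eq_getElem _ _ hlen]
    exact List.getElem_mem hlen
  have h2 := h _ hrow
  rw [List.all_eq_true] at h2
  rw [gPt_row L lam hi] at h2
  have hmem : gAt (gresCellTab L (cosTab L) lam lam) i j ∈ (List.range L).map (gAt (gresCellTab L (cosTab L) lam lam) i) :=
    List.mem_map.2 ⟨j, List.mem_range.2 hj, rfl⟩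
  have := h2 _ hmem
  exact of_decide_eq_true this

/-! ## Exact accumulation: `dotP`, `rowCorr`, `tSumP` -/

omit [NeZero L] in
/-- lower bound of the exact accumulation (nonnegative lower ends below `x·D`, `y·D`). [folklore] -/
theorem dotP_lower : ∀ (l1 l2 : List Iv) (x y : ℕ → ℝ) (acc : ℤ × ℤ), l1.length = l2.length →
    (∀ j : ℕ, j < l1.length → 0 ≤ (((getIv l1 j).1 : ℤ) : ℝ) ∧ (((getIv l1 j).1 : ℤ) : ℝ) ≤ x j * ((D : ℤ) : ℝ)) →
    (∀ j : ℕ, j < l2.length → 0 ≤ (((getIv l2 j).1 : ℤ) : ℝ) ∧ (((getIv l2 j).1 : ℤ) : ℝ) ≤ y j * ((D : ℤ) : ℝ)) →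
    (((dotP l1 l2 acc).1 : ℤ) : ℝ) ≤ (acc.1 : ℝ) + (∑ j ∈ range l1.length, x j * y j) * ((D : ℤ) : ℝ) * ((D : ℤ) : ℝ)
  | [], [], x, y, acc, _, _, _ => by simp [dotP]
  | [], _ :: _, x, y, acc, hlen, _, _ => by simp at hlen
  | _ :: _, [], x, y, acc, hlen, _, _ => by simp at hlen
  | a :: as, b :: bs, x, y, acc, hlen, hx, hy => by
      simp only [List.length_cons] at hlen hx hy ⊢
      rw [Finset.sum_range_succ', dotP]
      have h0x := hx 0 (by omega)
      have h0y := hy 0 (by omega)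
      simp only [getIv, List.getD_cons_zero] at h0x h0y
      have ih := dotP_lower as bs (fun j => x (j + 1)) (fun j => y (j + 1)) (acc.1 + a.1 * b.1, acc.2 + a.2 * b.2)
        (by omega) (fun j hj => by
          have := hx (j + 1) (by omega)
          simpa only [getIv, List.getD_cons_succ] using this)
        (fun j hj => by
          have := hy (j + 1) (by omega)
          simpa only [getIv, List.getD_cons_succ] using this)
      have hab : ((a.1 : ℤ) : ℝ) * ((b.1 : ℤ) : ℝ) ≤ x 0 * ((D : ℤ) : ℝ) * (y 0 * ((D : ℤ) : ℝ)) :=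
        mul_le_mul h0x.2 h0y.2 h0y.1 (h0x.1.trans h0x.2)
      push_cast at ih ⊢
      nlinarith [ih, hab]

omit [NeZero L] in
/-- upper bound of the exact accumulation (nonnegative `x·D`, `y·D` below the upper ends). [folklore] -/
theorem dotP_upper : ∀ (l1 l2 : List Iv) (x y : ℕ → ℝ) (acc : ℤ × ℤ), l1.length = l2.length →
    (∀ j : ℕ, j < l1.length → 0 ≤ x j * ((D : ℤ) : ℝ) ∧ x j * ((D : ℤ) : ℝ) ≤ (((getIv l1 j).2 : ℤ) : ℝ)) →
    (∀ j : ℕ, j < l2.length → 0 ≤ y j * ((D : ℤ) : ℝ) ∧ y j * ((D : ℤ) : ℝ) ≤ (((getIv l2 j).2 : ℤ) : ℝ)) →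
    (acc.2 : ℝ) + (∑ j ∈ range l1.length, x j * y j) * ((D : ℤ) : ℝ) * ((D : ℤ) : ℝ) ≤ (((dotP l1 l2 acc).2 : ℤ) : ℝ)
  | [], [], x, y, acc, _, _, _ => by simp [dotP]
  | [], _ :: _, x, y, acc, hlen, _, _ => by simp at hlen
  | _ :: _, [], x, y, acc, hlen, _, _ => by simp at hlen
  | a :: as, b :: bs, x, y, acc, hlen, hx, hy => by
      simp only [List.length_cons] at hlen hx hy ⊢
      rw [Finset.sum_range_succ', dotP]
      have h0x := hx 0 (by omega)
      have h0y := hy 0 (by omega)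
      simp only [getIv, List.getD_cons_zero] at h0x h0y
      have ih := dotP_upper as bs (fun j => x (j + 1)) (fun j => y (j + 1)) (acc.1 + a.1 * b.1, acc.2 + a.2 * b.2)
        (by omega) (fun j hj => by
          have := hx (j + 1) (by omega)
          simpa only [getIv, List.getD_cons_succ] using this)
        (fun j hj => by
          have := hy (j + 1) (by omega)
          simpa only [getIv, List.getD_cons_succ] using this)
      have hab : x 0 * ((D : ℤ) : ℝ) * (y 0 * ((D : ℤ) : ℝ)) ≤ ((a.2 : ℤ) : ℝ) * ((b.2 : ℤ) : ℝ) :=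
        mul_le_mul h0x.2 h0y.2 h0y.1 (h0x.1.trans h0x.2)
      push_cast at ih ⊢
      nlinarith [ih, hab]

end FinXB

end Summit.HubbardSuperconductivity.HubbardSuperconductivity.Theorems.AnisotropyChord.Transfer.Fibre3
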